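import Literature.NumberTheory.ZetaValues.AperyLikeGeneratingFunctions

/-!
# Rivoal's finite identity (Theorem 1.2 of [Rivoal2004]) — PROOF of the named fact `rivoal2004_theorem12`

Topic `Literature/NumberTheory/ZetaValues`; companion PROOF module of `AperyLikeGeneratingFunctions.lean` (statements).
Discharges `Literature.NumberTheory.ZetaValues.rivoal2004_theorem12` by `rivoal2004_theorem12_holds`:

* [Rivoal2004, Theorem 1.2, p. 505] "Let `g(X) ∈ ℂ[X]` be of degree at most `2`. For any integer `n ≥ 1` and any complex
  numbers `a` and `t`, with `a ∉ {±1, ±2, …, ±n}`, we have that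
  `Σ_{k=1}^{n} (−1)^{n−k} C(2n, n−k) (4k²/(k²−a²)) (∏_{0≤j<n−k or n<j<n+k} (t(k²−a²) + g(j)) − ∏_{same j} g(j)) = 0`."
  (For `a = 0` "the key identity proved in [Almkvist and Granville 99]".)

## The printed proof and this formalisation

The printed proof [Rivoal2004, §5 "Proof of Theorem 1.2", p. 507] rests on two results of [AlmkvistGranville1999]:
*Proposition 1* — for `F_k(X) = ∏_{j ∈ J_k} (X − g(j))`, `J_k = {0 ≤ j < n−k} ∪ {n < j < n+k}`, one has
`F_k(X) − F_k(0) = Σ_{r=0}^{n−2} Q_r(k² − a²) X^{n−1−r}` with `deg Q_r ≤ r` (5–1) — and *Lemma 1* = (5–3):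
`Σ_{k=1}^{n} (−1)^{n−k} C(2n, n−k) k^{2ℓ} = 0` for `1 ≤ ℓ ≤ n − 1`. Expanding (1–5) in powers of `t` (5–2), every
coefficient is `Σ_k (−1)^{n−k} C(2n,n−k) P(k²)` with `deg P ≤ n − 1` and `P(0) = 0`, hence `0`. We follow this road:

* `exists_coeff_prod_rivoalIndexSet_eq` = Proposition 1 in the form (1–5) uses (`X + g(j)` for `X − g(j)`): the
  `X^i`-coefficient of `∏_{j∈J_k}(X + g(j))` is an even polynomial in `k` of degree `≤ 2(n − 1 − i)`. Our proof is by
  the insertion recursion `J_{k+1} ∪ {n−k−1} = J_k ∪ {n+k}` (`insert_rivoalIndexSet_succ`): the increment of the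
  coefficient from `k` to `k+1` is `φ(k) − φ(−k−1)` for a polynomial `φ`, which sums to `Φ(k) + Φ(−k) + const` for a
  discrete antiderivative `Φ` of `φ` — manifestly even, of the right degree (the source cites Almkvist–Granville's
  power-sum computation instead; a deliberate, shorter deviation).
* `sum_neg_one_pow_mul_choose_mul_eval_eq_zero` = Lemma 1 / (5–3) for even polynomials `E` with `deg E < 2n`, `E(0) = 0`:
  Mathlib's vanishing of the `2n`-th forward difference of a polynomial of degree `< 2n`
  (`Polynomial.fwdDiff_iter_eq_zero_of_degree_lt`) at `−n`, folded by the symmetry `j ↦ 2n − j`.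
* `rivoal2004_theorem12_holds` = the assembly (5–2).

No definitions, no new named facts; private lemmas are elementary plumbing (discrete antiderivatives of polynomials in
the falling-factorial basis, even/odd splitting of a coefficient sum, `Σ_{Icc 1 n}` ↔ `Σ_{range n}`).
-/

noncomputable section

open Finset Polynomial
open scoped BigOperators

namespace Literature.NumberTheory.ZetaValues

section RivoalTheorem12

variable {K : Type*} [Field K] [CharZero K]

/-! #### Step 0: combinatorics of the index sets `J_k = {0 ≤ j < n − k} ∪ {n < j < n + k}` -/

omit [CharZero K] in
/-- The two blocks of `J_k` are disjoint. [cite: Rivoal2004, Theorem 1.2 p. 505] -/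
theorem rivoalIndexSet_disjoint (n k : ℕ) : Disjoint (Finset.range (n - k)) (Finset.Ioo n (n + k)) := by
  rw [Finset.disjoint_left]
  intro x hx hx'
  rw [Finset.mem_range] at hx
  rw [Finset.mem_Ioo] at hx'
  omega

/-- `#J_k = n − 1` for `1 ≤ k ≤ n`. [cite: Rivoal2004, §5 p. 507 ("the polynomial of degree n − 1 F_k(X)")] -/
theorem card_rivoalIndexSet {n k : ℕ} (hk : 1 ≤ k) (hkn : k ≤ n) : (rivoalIndexSet n k).card = n - 1 := by
  rw [rivoalIndexSet, Finset.card_union_of_disjoint (rivoalIndexSet_disjoint n k), Finset.card_range,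
    Nat.card_Ioo]
  omega

/-- `n − k − 1 ∉ J_{k+1}`. [cite: Rivoal2004, Theorem 1.2 p. 505] -/
theorem not_mem_rivoalIndexSet_succ (n k : ℕ) : n - k - 1 ∉ rivoalIndexSet n (k + 1) := by
  intro h
  rw [rivoalIndexSet, Finset.mem_union, Finset.mem_range, Finset.mem_Ioo] at h
  omega

/-- `n + k ∉ J_k`. [cite: Rivoal2004, Theorem 1.2 p. 505] -/
theorem not_mem_rivoalIndexSet (n k : ℕ) : n + k ∉ rivoalIndexSet n k := by
  intro h
  rw [rivoalIndexSet, Finset.mem_union, Finset.mem_range, Finset.mem_Ioo] at h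
  omega

/-- The insertion identity `J_{k+1} ∪ {n−k−1} = J_k ∪ {n+k}` (`1 ≤ k ≤ n − 1`), i.e.
`F_{k+1}(X)·(X − g(n−k−1)) = F_k(X)·(X − g(n+k))`. [cite: Rivoal2004, §5 p. 507 (definition of F_k)] -/
theorem insert_rivoalIndexSet_succ {n k : ℕ} (hk : 1 ≤ k) (hkn : k + 1 ≤ n) :
    insert (n - k - 1) (rivoalIndexSet n (k + 1)) = insert (n + k) (rivoalIndexSet n k) := by
  ext x
  rw [rivoalIndexSet, rivoalIndexSet, Finset.mem_insert, Finset.mem_union, Finset.mem_range, Finset.mem_Ioo,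
    Finset.mem_insert, Finset.mem_union, Finset.mem_range, Finset.mem_Ioo]
  omega

/-! #### Step 1: the coefficient recursion for `F_k(X) = ∏_{j ∈ J_k} (X + g(j))` -/

omit [CharZero K] in
/-- `[X^{i+1}] ((X + b)·p) = [X^i] p + b·[X^{i+1}] p`. [folklore] -/
private theorem coeff_X_add_C_mul_succ (b : K) (p : K[X]) (i : ℕ) :
    ((X + C b) * p).coeff (i + 1) = p.coeff i + b * p.coeff (i + 1) := by
  rw [add_mul, coeff_add, coeff_X_mul, coeff_C_mul]

omit [CharZero K] in
/-- The coefficient recursion coming from `J_{k+1} ∪ {n−k−1} = J_k ∪ {n+k}`: for every `i`,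
`[X^i]F_{k+1} + g(n−k−1)[X^{i+1}]F_{k+1} = [X^i]F_k + g(n+k)[X^{i+1}]F_k`.
[cite: Rivoal2004, §5 p. 507 (F_k)] -/
theorem coeff_prod_rivoalIndexSet_succ (v : ℕ → K) {n k : ℕ} (hk : 1 ≤ k) (hkn : k + 1 ≤ n) (i : ℕ) :
    (∏ j ∈ rivoalIndexSet n (k + 1), (X + C (v j))).coeff i +
        v (n - k - 1) * (∏ j ∈ rivoalIndexSet n (k + 1), (X + C (v j))).coeff (i + 1) =
      (∏ j ∈ rivoalIndexSet n k, (X + C (v j))).coeff i +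
        v (n + k) * (∏ j ∈ rivoalIndexSet n k, (X + C (v j))).coeff (i + 1) := by
  have h1 := Finset.prod_insert (f := fun j => X + C (v j)) (not_mem_rivoalIndexSet_succ n k)
  have h2 := Finset.prod_insert (f := fun j => X + C (v j)) (not_mem_rivoalIndexSet n k)
  have h := congrArg (fun q : K[X] => q.coeff (i + 1))
    (show (∏ j ∈ insert (n - k - 1) (rivoalIndexSet n (k + 1)), (X + C (v j))) =
        ∏ j ∈ insert (n + k) (rivoalIndexSet n k), (X + C (v j)) by rw [insert_rivoalIndexSet_succ hk hkn])
  rw [h1, h2, coeff_X_add_C_mul_succ, coeff_X_add_C_mul_succ] at h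
  exact h

omit [CharZero K] in
/-- `deg F_k ≤ n − 1`. [cite: Rivoal2004, §5 p. 507] -/
theorem natDegree_prod_rivoalIndexSet_le (v : ℕ → K) {n k : ℕ} (hk : 1 ≤ k) (hkn : k ≤ n) :
    (∏ j ∈ rivoalIndexSet n k, (X + C (v j))).natDegree ≤ n - 1 := by
  refine (natDegree_prod_le _ _).trans ?_
  have : ∑ j ∈ rivoalIndexSet n k, (X + C (v j)).natDegree ≤ ∑ _j ∈ rivoalIndexSet n k, 1 :=
    Finset.sum_le_sum fun j _ => (natDegree_add_le_of_degree_le (natDegree_X_le) (by simp))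
  refine this.trans ?_
  rw [Finset.sum_const, smul_eq_mul, mul_one, card_rivoalIndexSet hk hkn]

/-! #### Step 2: discrete antiderivatives of polynomials -/

omit [CharZero K] in
/-- The falling-factorial basis `∏_{j<m} (X − j)` has degree `m`… [folklore] -/
private theorem natDegree_prod_X_sub_natCast (m : ℕ) :
    (∏ j ∈ Finset.range m, (X - C (j : K))).natDegree = m ∧
      (∏ j ∈ Finset.range m, (X - C (j : K))).Monic := by
  refine ⟨?_, monic_prod_of_monic _ _ fun j _ => monic_X_sub_C _⟩
  rw [natDegree_prod_of_monic _ _ fun j _ => monic_X_sub_C _]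
  simp only [natDegree_X_sub_C, Finset.sum_const, Finset.card_range, smul_eq_mul, mul_one]

omit [CharZero K] in
/-- … and forward difference `Δ ∏_{j<m+1}(X − j) = (m+1) ∏_{j<m}(X − j)`. [folklore] -/
private theorem eval_prod_X_sub_natCast_succ_sub (m : ℕ) (x : K) :
    (∏ j ∈ Finset.range (m + 1), (X - C (j : K))).eval (x + 1) -
        (∏ j ∈ Finset.range (m + 1), (X - C (j : K))).eval x =
      ((m : K) + 1) * (∏ j ∈ Finset.range m, (X - C (j : K))).eval x := by
  rw [eval_prod, eval_prod, eval_prod, Finset.prod_range_succ', Finset.prod_range_succ]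
  have : ∏ j ∈ Finset.range m, (X - C (((j + 1 : ℕ) : K))).eval (x + 1) =
      ∏ j ∈ Finset.range m, (X - C (j : K)).eval x := by
    refine Finset.prod_congr rfl fun j _ => ?_
    simp only [eval_sub, eval_X, eval_C, Nat.cast_succ]
    ring
  rw [this]
  simp only [eval_sub, eval_X, eval_C, Nat.cast_zero]
  ring

/-- Every polynomial `φ` of degree `≤ d` has a discrete antiderivative `Φ` of degree `≤ d + 1`:
`Φ(x+1) − Φ(x) = φ(x)`. [folklore] -/
private theorem exists_fwdDiff_eq_of_natDegree_le :
    ∀ (d : ℕ) (φ : K[X]), φ.natDegree ≤ d →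
      ∃ Φ : K[X], Φ.natDegree ≤ d + 1 ∧ ∀ x : K, Φ.eval (x + 1) - Φ.eval x = φ.eval x := by
  intro d
  induction d with
  | zero =>
    intro φ hφ
    refine ⟨C (φ.coeff 0) * X, ?_, fun x => ?_⟩
    · exact (natDegree_C_mul_le _ _).trans (natDegree_X_le)
    · rw [eq_C_of_natDegree_le_zero hφ]
      simp only [eval_mul, eval_C, eval_X, coeff_C_zero]
      ring
  | succ d ih =>
    intro φ hφ
    set b : K[X] := ∏ j ∈ Finset.range (d + 1), (X - C (j : K)) with hb
    set c : K := φ.coeff (d + 1) with hc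
    have hbdeg := (natDegree_prod_X_sub_natCast (K := K) (d + 1)).1
    have hbmon := (natDegree_prod_X_sub_natCast (K := K) (d + 1)).2
    -- lower the degree
    have hψ : (φ - C c * b).natDegree ≤ d := by
      rw [natDegree_le_iff_coeff_eq_zero]
      intro N hN
      rw [coeff_sub, coeff_C_mul]
      rcases (Nat.succ_le_of_lt hN).eq_or_lt with h | h
      · -- N = d + 1
        have hN1 : N = d + 1 := by exact_mod_cast h.symm
        subst hN1
        have : b.coeff (d + 1) = 1 := by
          have := hbmon.coeff_natDegree; rwa [hbdeg] at this
        rw [this, mul_one, hc, sub_self]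
      · have h1 : φ.coeff N = 0 := coeff_eq_zero_of_natDegree_lt (hφ.trans_lt (by exact_mod_cast h))
        have h2 : b.coeff N = 0 := coeff_eq_zero_of_natDegree_lt (hbdeg ▸ (by exact_mod_cast h))
        rw [h1, h2, mul_zero, sub_zero]
    obtain ⟨Ψ, hΨdeg, hΨ⟩ := ih _ hψ
    set b' : K[X] := ∏ j ∈ Finset.range (d + 2), (X - C (j : K)) with hb'
    have hb'deg := (natDegree_prod_X_sub_natCast (K := K) (d + 2)).1
    have hd2 : (d : K) + 2 ≠ 0 := by exact_mod_cast (Nat.succ_ne_zero (d + 1))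
    refine ⟨Ψ + C (c / ((d : K) + 2)) * b', ?_, fun x => ?_⟩
    · refine natDegree_add_le_of_degree_le (hΨdeg.trans (Nat.le_succ _)) ?_
      exact (natDegree_C_mul_le _ _).trans hb'deg.le
    · have key := eval_prod_X_sub_natCast_succ_sub (K := K) (d + 1) x
      have hΨx := hΨ x
      rw [eval_sub, eval_mul, eval_C] at hΨx
      simp only [eval_add, eval_mul, eval_C]
      rw [hb'] 
      have : (((d + 1 : ℕ) : K) + 1) = (d : K) + 2 := by push_cast; ring
      rw [this] at key
      -- Φ(x+1) − Φ(x) = ψ(x) + (c/(d+2)) (b'(x+1) − b'(x)) = ψ(x) + c b(x) = φ(x)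
      have e1 : eval (x + 1) Ψ + c / ((d : K) + 2) * eval (x + 1) (∏ j ∈ Finset.range (d + 2), (X - C (j : K))) -
          (eval x Ψ + c / ((d : K) + 2) * eval x (∏ j ∈ Finset.range (d + 2), (X - C (j : K)))) =
          (eval (x + 1) Ψ - eval x Ψ) + c / ((d : K) + 2) *
            (eval (x + 1) (∏ j ∈ Finset.range (d + 2), (X - C (j : K))) -
              eval x (∏ j ∈ Finset.range (d + 2), (X - C (j : K)))) := by ring
      rw [e1, key, hΨx, hb]
      field_simp
      ring

/-! #### Step 3: symmetrisation `Φ(x) + Φ(−x)` is an even polynomial of controlled degree -/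

omit [CharZero K] in
/-- `Σ_{i < 2M} f(i) = Σ_{j < M} (f(2j) + f(2j+1))`. [folklore] -/
private theorem sum_range_two_mul_eq {A : Type*} [AddCommMonoid A] (f : ℕ → A) (M : ℕ) :
    ∑ i ∈ Finset.range (2 * M), f i = ∑ j ∈ Finset.range M, (f (2 * j) + f (2 * j + 1)) := by
  induction M with
  | zero => simp
  | succ M ih =>
    rw [show 2 * (M + 1) = 2 * M + 1 + 1 by ring, Finset.sum_range_succ, Finset.sum_range_succ, ih,
      Finset.sum_range_succ, add_assoc]

omit [CharZero K] in
/-- If `deg Φ ≤ 2M + 1` then `Φ(x) + Φ(−x) = Σ_{j ≤ M} c_j x^{2j}` for suitable constants `c_j`. [folklore] -/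
private theorem exists_eval_add_eval_neg_eq (Φ : K[X]) (M : ℕ) (hΦ : Φ.natDegree ≤ 2 * M + 1) :
    ∃ c : ℕ → K, ∀ x : K, Φ.eval x + Φ.eval (-x) = ∑ j ∈ Finset.range (M + 1), c j * x ^ (2 * j) := by
  refine ⟨fun j => 2 * Φ.coeff (2 * j), fun x => ?_⟩
  have hlt : Φ.natDegree < 2 * (M + 1) := by omega
  rw [eval_eq_sum_range' hlt, eval_eq_sum_range' hlt, ← Finset.sum_add_distrib, sum_range_two_mul_eq]
  refine Finset.sum_congr rfl fun j _ => ?_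
  rw [Even.neg_pow (even_two_mul j), Odd.neg_pow (odd_two_mul_add_one j)]
  ring

/-! #### Step 4: Almkvist–Granville's Proposition 1 — the coefficients of `F_k` are even polynomials in `k` -/

/-- **KEY LEMMA** ([AlmkvistGranville1999] Proposition 1 in Rivoal's generality, eq. (5–1)): for `deg g ≤ 2` and
`1 ≤ i` there are constants `c_j` with `[X^i] ∏_{j ∈ J_k}(X + g(j)) = Σ_{j < n−i} c_j k^{2j}` for all `1 ≤ k ≤ n`,
i.e. the `X^i`-coefficient of `F_k` is an even polynomial in `k` of degree `≤ 2(n − 1 − i)`. Proof (ours, by the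
insertion recursion `J_{k+1} ∪ {n−k−1} = J_k ∪ {n+k}` rather than the source's power sums): downward induction
on `i`; the increment `[X^i]F_{k+1} − [X^i]F_k = φ(k) − φ(−k−1)` with `φ(x) = g(n+x)·P_{i+1}(x)` integrates to
`Φ(k) + Φ(−k) + const` for a discrete antiderivative `Φ` of `φ`. [cite: Rivoal2004, §5 p. 507, eq. (5–1)] -/
theorem exists_coeff_prod_rivoalIndexSet_eq (g : K[X]) (hg : g.natDegree ≤ 2) (n : ℕ) :
    ∀ i : ℕ, 1 ≤ i → ∃ c : ℕ → K, ∀ k ∈ Finset.Icc 1 n,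
      (∏ j ∈ rivoalIndexSet n k, (X + C (g.eval (j : K)))).coeff i =
        ∑ j ∈ Finset.range (n - i), c j * (k : K) ^ (2 * j) := by
  -- the trivial case `i ≥ n`: the coefficient vanishes
  have triv : ∀ i : ℕ, n ≤ i → ∃ c : ℕ → K, ∀ k ∈ Finset.Icc 1 n,
      (∏ j ∈ rivoalIndexSet n k, (X + C (g.eval (j : K)))).coeff i =
        ∑ j ∈ Finset.range (n - i), c j * (k : K) ^ (2 * j) := by
    intro i hi
    refine ⟨fun _ => 0, fun k hk => ?_⟩
    rw [Finset.mem_Icc] at hk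
    rw [Nat.sub_eq_zero_of_le hi, Finset.sum_range_zero]
    exact coeff_eq_zero_of_natDegree_lt ((natDegree_prod_rivoalIndexSet_le _ hk.1 hk.2).trans_lt (by omega))
  -- downward induction on `i`, measured by `m` with `n ≤ i + m`
  suffices H : ∀ m i : ℕ, 1 ≤ i → n ≤ i + m → ∃ c : ℕ → K, ∀ k ∈ Finset.Icc 1 n,
      (∏ j ∈ rivoalIndexSet n k, (X + C (g.eval (j : K)))).coeff i =
        ∑ j ∈ Finset.range (n - i), c j * (k : K) ^ (2 * j) from
    fun i hi => H n i hi (Nat.le_add_left n i)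
  intro m
  induction m with
  | zero => intro i hi hni; exact triv i (by simpa using hni)
  | succ m ih =>
    intro i hi hni
    rcases le_or_gt n i with hin | hin
    · exact triv i hin
    obtain ⟨c, hc⟩ := ih (i + 1) (by omega) (by omega)
    -- the even polynomial `p = P_{i+1}` of the induction hypothesis, `M = n − i − 1` terms
    set M : ℕ := n - (i + 1) with hM
    set p : K[X] := ∑ j ∈ Finset.range M, C (c j) * X ^ (2 * j) with hp
    have hp_eval : ∀ y : K, p.eval y = ∑ j ∈ Finset.range M, c j * y ^ (2 * j) := by
      intro y; simp [hp, eval_finsetSum]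
    have hp_even : ∀ y : K, p.eval (-y) = p.eval y := by
      intro y; rw [hp_eval, hp_eval]
      exact Finset.sum_congr rfl fun j _ => by rw [Even.neg_pow (even_two_mul j)]
    -- `h(x) = g(n + x)`
    set h : K[X] := g.comp (X + C (n : K)) with hh
    have hh_eval : ∀ y : K, h.eval y = g.eval (y + n) := by
      intro y; simp [hh, eval_comp]
    have hh_deg : h.natDegree ≤ 2 := by
      rw [hh, natDegree_comp, natDegree_X_add_C, mul_one]; exact hg
    -- `φ = h·p` has degree `≤ 2M`
    have hφ_deg : (h * p).natDegree ≤ 2 * M := by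
      rcases Nat.eq_zero_or_pos M with hM0 | hMpos
      · have hp0 : p = 0 := by rw [hp, hM0, Finset.sum_range_zero]
        rw [hp0, mul_zero, natDegree_zero]; exact Nat.zero_le _
      · have hpdeg : p.natDegree ≤ 2 * (M - 1) := by
          rw [hp]
          refine natDegree_sum_le_of_forall_le _ _ fun j hj => ?_
          rw [Finset.mem_range] at hj
          exact (natDegree_C_mul_le _ _).trans ((natDegree_X_pow_le _).trans (by omega))
        exact natDegree_mul_le.trans (by omega)
    obtain ⟨Φ, hΦdeg, hΦ⟩ := exists_fwdDiff_eq_of_natDegree_le (2 * M) (h * p) hφ_deg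
    -- the recursion: `[X^i]F_k − Φ(k) − Φ(−k)` is constant in `k ∈ [1, n]`
    have step : ∀ k : ℕ, 1 ≤ k → k + 1 ≤ n →
        (∏ j ∈ rivoalIndexSet n (k + 1), (X + C (g.eval (j : K)))).coeff i
            - Φ.eval ((k : K) + 1) - Φ.eval (-((k : K) + 1)) =
          (∏ j ∈ rivoalIndexSet n k, (X + C (g.eval (j : K)))).coeff i
            - Φ.eval (k : K) - Φ.eval (-(k : K)) := by
      intro k hk1 hkn
      have hrec := coeff_prod_rivoalIndexSet_succ (fun j => g.eval (j : K)) hk1 hkn i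
      have hk' : k ∈ Finset.Icc 1 n := by rw [Finset.mem_Icc]; omega
      have hk1' : k + 1 ∈ Finset.Icc 1 n := by rw [Finset.mem_Icc]; omega
      rw [hc k hk', hc (k + 1) hk1'] at hrec
      have e1 : g.eval (((n + k : ℕ) : K)) = h.eval (k : K) := by
        rw [hh_eval]; push_cast; ring_nf
      have e2 : g.eval (((n - k - 1 : ℕ) : K)) = h.eval (-((k : K) + 1)) := by
        rw [hh_eval]; congr 1
        rw [Nat.sub_sub, Nat.cast_sub (by omega)]; push_cast; ring
      have e3 : (∑ j ∈ Finset.range M, c j * ((k : ℕ) : K) ^ (2 * j)) = p.eval (k : K) := (hp_eval _).symm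
      have e4 : (∑ j ∈ Finset.range M, c j * (((k + 1 : ℕ) : K)) ^ (2 * j)) = p.eval (-((k : K) + 1)) := by
        rw [hp_even, hp_eval]; push_cast; rfl
      rw [e1, e2, e3, e4] at hrec
      have d1 := hΦ (k : K)
      have d2 := hΦ (-((k : K) + 1))
      rw [eval_mul] at d1 d2
      rw [show (-((k : K) + 1) + 1) = -(k : K) by ring] at d2
      linear_combination hrec - d1 + d2
    have const : ∀ k : ℕ, k ∈ Finset.Icc 1 n →
        (∏ j ∈ rivoalIndexSet n k, (X + C (g.eval (j : K)))).coeff i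
            - Φ.eval (k : K) - Φ.eval (-(k : K)) =
          (∏ j ∈ rivoalIndexSet n 1, (X + C (g.eval (j : K)))).coeff i
            - Φ.eval (1 : K) - Φ.eval (-(1 : K)) := by
      intro k hk
      rw [Finset.mem_Icc] at hk
      obtain ⟨hk1, hkn⟩ := hk
      induction k with
      | zero => omega
      | succ k ihk =>
        rcases Nat.eq_zero_or_pos k with rfl | hkpos
        · simp
        · rw [← ihk hkpos (by omega)]
          have := step k hkpos hkn
          push_cast
          exact this
    -- symmetrise `Φ`
    obtain ⟨c', hc'⟩ := exists_eval_add_eval_neg_eq Φ M hΦdeg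
    set T1 : K := (∏ j ∈ rivoalIndexSet n 1, (X + C (g.eval (j : K)))).coeff i
        - Φ.eval (1 : K) - Φ.eval (-(1 : K)) with hT1
    refine ⟨fun j => if j = 0 then c' 0 + T1 else c' j, fun k hk => ?_⟩
    have hMi : n - i = M + 1 := by omega
    have main : (∏ j ∈ rivoalIndexSet n k, (X + C (g.eval (j : K)))).coeff i =
        (Φ.eval (k : K) + Φ.eval (-(k : K))) + T1 := by
      have := const k hk; rw [hT1]; linear_combination this
    rw [main, hc' (k : K), hMi, Finset.sum_range_succ', Finset.sum_range_succ']
    simp only [Nat.add_one_ne_zero, if_false, if_true]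
    ring

omit [CharZero K] in
/-- `Σ_{k=1}^{n} f(k) = Σ_{j<n} f(j+1)`. [folklore] -/
private theorem rivoal_sum_Icc_eq_sum_range {A : Type*} [AddCommMonoid A] (f : ℕ → A) (n : ℕ) :
    ∑ i ∈ Finset.Icc 1 n, f i = ∑ j ∈ Finset.range n, f (j + 1) := by
  induction n with
  | zero => simp
  | succ n ih => rw [Finset.sum_Icc_succ_top (by omega), ih, Finset.sum_range_succ]

/-! #### Step 5: Almkvist–Granville's Lemma 1, eq. (5–3) -/

/-- **(5–3)** in polynomial form ([AlmkvistGranville1999] Lemma 1: `Σ_{k=1}^{n} (−1)^{n−k} C(2n,n−k) k^{2ℓ} = 0`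
for `1 ≤ ℓ ≤ n − 1`): for a polynomial `E` with `E(−x) = E(x)`, `deg E < 2n` and `E(0) = 0`,
`Σ_{k=1}^{n} (−1)^{n−k} C(2n, n−k) E(k) = 0`. Proof: the `2n`-th forward difference of `E` at `−n` vanishes
(Mathlib's `Polynomial.fwdDiff_iter_eq_zero_of_degree_lt`) and folds, by the symmetry `j ↦ 2n − j`, onto twice
the displayed sum. [cite: Rivoal2004, §5 p. 507, eq. (5–3)] -/
theorem sum_neg_one_pow_mul_choose_mul_eval_eq_zero {n : ℕ} (E : K[X]) (hE : E.natDegree < 2 * n)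
    (heven : ∀ x : K, E.eval (-x) = E.eval x) (h0 : E.eval 0 = 0) :
    ∑ k ∈ Finset.Icc 1 n, (-1 : K) ^ (n - k) * ((2 * n).choose (n - k) : K) * E.eval (k : K) = 0 := by
  have H := Polynomial.fwdDiff_iter_eq_zero_of_degree_lt hE
  have H1 : ∑ j ∈ Finset.range (2 * n + 1),
      (-1 : K) ^ (2 * n - j) * ((2 * n).choose j : K) * E.eval (-(n : K) + (j : K)) = 0 := by
    have H0 := congrFun H (-(n : K))
    rw [fwdDiff_iter_eq_sum_shift, Pi.zero_apply] at H0
    rw [← H0]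
    refine Finset.sum_congr rfl fun j _ => ?_
    rw [zsmul_eq_mul, nsmul_eq_mul, mul_one]
    push_cast
    ring
  rw [← Finset.sum_range_add_sum_Ico _ (show n ≤ 2 * n + 1 by omega),
    Finset.sum_eq_sum_Ico_succ_bot (show n < 2 * n + 1 by omega), neg_add_cancel, h0, mul_zero,
    zero_add] at H1
  -- the block `j < n`, reflected, is the displayed sum (by evenness)
  have hA : ∑ j ∈ Finset.range n, (-1 : K) ^ (2 * n - j) * ((2 * n).choose j : K) * E.eval (-(n : K) + (j : K)) =
      ∑ k ∈ Finset.Icc 1 n, (-1 : K) ^ (n - k) * ((2 * n).choose (n - k) : K) * E.eval (k : K) := by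
    rw [← Finset.sum_range_reflect, rivoal_sum_Icc_eq_sum_range]
    refine Finset.sum_congr rfl fun j hj => ?_
    rw [Finset.mem_range] at hj
    have e1 : 2 * n - (n - 1 - j) = (n - (j + 1)) + 2 * (j + 1) := by omega
    have e2 : (2 * n).choose (n - 1 - j) = (2 * n).choose (n - (j + 1)) := by congr 1; omega
    have e3 : (-(n : K) + ((n - 1 - j : ℕ) : K)) = -(((j + 1 : ℕ) : K)) := by
      rw [Nat.sub_sub, Nat.cast_sub (by omega)]; push_cast; ring
    rw [e1, pow_add, pow_mul, neg_one_sq, one_pow, mul_one, e2, e3, heven]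
  -- the block `j > n` is the displayed sum (by `C(2n, n+k) = C(2n, n−k)`)
  have hB : ∑ j ∈ Finset.Ico (n + 1) (2 * n + 1),
        (-1 : K) ^ (2 * n - j) * ((2 * n).choose j : K) * E.eval (-(n : K) + (j : K)) =
      ∑ k ∈ Finset.Icc 1 n, (-1 : K) ^ (n - k) * ((2 * n).choose (n - k) : K) * E.eval (k : K) := by
    rw [Finset.sum_Ico_eq_sum_range, rivoal_sum_Icc_eq_sum_range, show 2 * n + 1 - (n + 1) = n by omega]
    refine Finset.sum_congr rfl fun j hj => ?_
    rw [Finset.mem_range] at hj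
    have e2 : (2 * n).choose (n + 1 + j) = (2 * n).choose (n - (j + 1)) := by
      rw [← Nat.choose_symm (show n + 1 + j ≤ 2 * n by omega)]; congr 1; omega
    have e1 : 2 * n - (n + 1 + j) = n - (j + 1) := by omega
    have e3 : (-(n : K) + ((n + 1 + j : ℕ) : K)) = (((j + 1 : ℕ) : K)) := by
      simp only [Nat.cast_add, Nat.cast_one]; ring
    rw [e1, e2, e3]
  rw [hA, hB, ← two_mul] at H1
  exact (mul_eq_zero.1 H1).resolve_left two_ne_zero

/-! #### Step 6: assembly — Rivoal's Theorem 1.2 -/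

/-- **Rivoal 2004, Theorem 1.2, PROVED** (discharge of the named fact `rivoal2004_theorem12`): for `deg g ≤ 2`,
`n ≥ 1` and `a ∉ {±1, …, ±n}`,
`Σ_{k=1}^{n} (−1)^{n−k} C(2n, n−k) (4k²/(k²−a²)) (∏_{j∈J_k} (t(k²−a²) + g(j)) − ∏_{j∈J_k} g(j)) = 0`.
Proof as printed in [Rivoal2004, §5 "Proof of Theorem 1.2"]: expand the products in powers of `t(k²−a²)`
(the constant terms cancel), so that by `exists_coeff_prod_rivoalIndexSet_eq` (A–G Proposition 1) the
coefficient of `t^{i+1}` is `Σ_k (−1)^{n−k} C(2n,n−k) P(k)` with `P(k) = 4k²(k²−a²)^i P_{i+1}(k)` an even polynomial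
of degree `≤ 2n − 2` vanishing at `0`, which is `0` by (5–3) (`sum_neg_one_pow_mul_choose_mul_eval_eq_zero`).
[cite: Rivoal2004, Theorem 1.2 (1–5) p. 505; proof §5 p. 507] -/
theorem rivoal2004_theorem12_holds : rivoal2004_theorem12 := by
  intro g hg n hn a t ha
  obtain ⟨m, rfl⟩ : ∃ m, n = m + 1 := ⟨n - 1, by omega⟩
  have hd : ∀ k ∈ Finset.Icc 1 (m + 1), (k : ℂ) ^ 2 - a ^ 2 ≠ 0 := by
    intro k hk h0
    obtain ⟨h1, h2⟩ := ha k hk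
    have hfac : ((k : ℂ) - a) * ((k : ℂ) + a) = 0 := by linear_combination h0
    rcases mul_eq_zero.1 hfac with h | h
    · exact h1 (by linear_combination -h)
    · exact h2 (by linear_combination h)
  -- the products are evaluations of `F_k = ∏_{j ∈ J_k} (X + g(j))`
  have hprod : ∀ (k : ℕ) (y : ℂ), ∏ j ∈ rivoalIndexSet (m + 1) k, (y + g.eval (j : ℂ)) =
      (∏ j ∈ rivoalIndexSet (m + 1) k, (X + C (g.eval (j : ℂ)))).eval y := by
    intro k y; rw [eval_prod]; simp
  -- A–G Proposition 1 for every coefficient index `i + 1`, `i < m`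
  have hcoef : ∀ i ∈ Finset.range m, ∃ c : ℕ → ℂ, ∀ k ∈ Finset.Icc 1 (m + 1),
      (∏ j ∈ rivoalIndexSet (m + 1) k, (X + C (g.eval (j : ℂ)))).coeff (i + 1) =
        ∑ j ∈ Finset.range (m + 1 - (i + 1)), c j * (k : ℂ) ^ (2 * j) :=
    fun i _ => exists_coeff_prod_rivoalIndexSet_eq g hg (m + 1) (i + 1) (by omega)
  choose! c hc using hcoef
  -- rewrite each summand as a polynomial in `t` without constant term
  have hsummand : ∀ k ∈ Finset.Icc 1 (m + 1),
      (-1 : ℂ) ^ (m + 1 - k) * ((2 * (m + 1)).choose (m + 1 - k) : ℂ) *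
          (4 * (k : ℂ) ^ 2 / ((k : ℂ) ^ 2 - a ^ 2)) *
          (∏ j ∈ rivoalIndexSet (m + 1) k, (t * ((k : ℂ) ^ 2 - a ^ 2) + g.eval (j : ℂ)) -
            ∏ j ∈ rivoalIndexSet (m + 1) k, g.eval (j : ℂ)) =
        ∑ i ∈ Finset.range m, t ^ (i + 1) *
          ((-1 : ℂ) ^ (m + 1 - k) * ((2 * (m + 1)).choose (m + 1 - k) : ℂ) *
            (4 * (k : ℂ) ^ 2 * ((k : ℂ) ^ 2 - a ^ 2) ^ i *
              ∑ j ∈ Finset.range (m - i), c i j * (k : ℂ) ^ (2 * j))) := by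
    intro k hk
    have hk' := Finset.mem_Icc.1 hk
    have hdk := hd k hk
    set F : ℂ[X] := ∏ j ∈ rivoalIndexSet (m + 1) k, (X + C (g.eval (j : ℂ))) with hF
    have hFdeg : F.natDegree < m + 1 :=
      (natDegree_prod_rivoalIndexSet_le _ hk'.1 hk'.2).trans_lt (by omega)
    have h1 : ∏ j ∈ rivoalIndexSet (m + 1) k, (t * ((k : ℂ) ^ 2 - a ^ 2) + g.eval (j : ℂ)) =
        F.eval (t * ((k : ℂ) ^ 2 - a ^ 2)) := hprod k _
    have h2 : ∏ j ∈ rivoalIndexSet (m + 1) k, g.eval (j : ℂ) = F.eval 0 := by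
      rw [← hprod k 0]; simp
    have hbr : F.eval (t * ((k : ℂ) ^ 2 - a ^ 2)) - F.eval 0 =
        ∑ i ∈ Finset.range m, F.coeff (i + 1) * (t * ((k : ℂ) ^ 2 - a ^ 2)) ^ (i + 1) := by
      rw [eval_eq_sum_range' hFdeg, eval_eq_sum_range' hFdeg, Finset.sum_range_succ', Finset.sum_range_succ']
      simp
    rw [h1, h2, hbr, Finset.mul_sum]
    refine Finset.sum_congr rfl fun i hi => ?_
    have hci := hc i hi k hk
    rw [show m + 1 - (i + 1) = m - i by omega] at hci
    rw [hci, mul_pow]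
    generalize (∑ j ∈ Finset.range (m - i), c i j * (k : ℂ) ^ (2 * j)) = S
    have hinv : ((k : ℂ) ^ 2 - a ^ 2)⁻¹ * ((k : ℂ) ^ 2 - a ^ 2) = 1 := inv_mul_cancel₀ hdk
    rw [div_eq_mul_inv]
    linear_combination ((-1 : ℂ) ^ (m + 1 - k) * ((2 * (m + 1)).choose (m + 1 - k) : ℂ) * 4 * (k : ℂ) ^ 2 *
      S * t ^ (i + 1) * ((k : ℂ) ^ 2 - a ^ 2) ^ i) * hinv
  rw [Finset.sum_congr rfl hsummand, Finset.sum_comm]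
  refine Finset.sum_eq_zero fun i hi => ?_
  rw [← Finset.mul_sum]
  have hi' := Finset.mem_range.1 hi
  -- the polynomial `E_i(X) = 4X²(X²−a²)^i P_{i+1}(X)`: even, `E_i(0) = 0`, `deg E_i ≤ 2m < 2(m+1)`
  set E : ℂ[X] := C 4 * X ^ 2 * (X ^ 2 - C (a ^ 2)) ^ i *
      ∑ j ∈ Finset.range (m - i), C (c i j) * X ^ (2 * j) with hE
  have hE_eval : ∀ y : ℂ, E.eval y =
      4 * y ^ 2 * (y ^ 2 - a ^ 2) ^ i * ∑ j ∈ Finset.range (m - i), c i j * y ^ (2 * j) := by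
    intro y; simp [hE, eval_finsetSum]
  have hE_deg : E.natDegree < 2 * (m + 1) := by
    have h1 : (C (4 : ℂ) * X ^ 2).natDegree ≤ 2 := (natDegree_C_mul_le _ _).trans (natDegree_X_pow_le _)
    have h2 : ((X ^ 2 - C (a ^ 2)) ^ i : ℂ[X]).natDegree ≤ 2 * i := by
      refine natDegree_pow_le.trans ?_
      have : (X ^ 2 - C (a ^ 2) : ℂ[X]).natDegree ≤ 2 :=
        (natDegree_sub_le_of_le (natDegree_X_pow_le 2) (natDegree_C _).le).trans (by simp)
      calc i * (X ^ 2 - C (a ^ 2) : ℂ[X]).natDegree ≤ i * 2 := Nat.mul_le_mul_left i this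
        _ = 2 * i := by ring
    have h3 : (∑ j ∈ Finset.range (m - i), C (c i j) * X ^ (2 * j) : ℂ[X]).natDegree ≤ 2 * (m - i - 1) := by
      refine natDegree_sum_le_of_forall_le _ _ fun j hj => ?_
      rw [Finset.mem_range] at hj
      exact (natDegree_C_mul_le _ _).trans ((natDegree_X_pow_le _).trans (by omega))
    have h12 : (C (4 : ℂ) * X ^ 2 * (X ^ 2 - C (a ^ 2)) ^ i).natDegree ≤ 2 + 2 * i :=
      natDegree_mul_le.trans (by omega)
    calc E.natDegree ≤ (C (4 : ℂ) * X ^ 2 * (X ^ 2 - C (a ^ 2)) ^ i).natDegree +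
          (∑ j ∈ Finset.range (m - i), C (c i j) * X ^ (2 * j) : ℂ[X]).natDegree := natDegree_mul_le
      _ ≤ (2 + 2 * i) + 2 * (m - i - 1) := Nat.add_le_add h12 h3
      _ < 2 * (m + 1) := by omega
  have hE_even : ∀ y : ℂ, E.eval (-y) = E.eval y := by
    intro y
    rw [hE_eval, hE_eval, neg_sq]
    congr 1
    exact Finset.sum_congr rfl fun j _ => by rw [Even.neg_pow (even_two_mul j)]
  have hE0 : E.eval 0 = 0 := by rw [hE_eval]; simp
  have key := sum_neg_one_pow_mul_choose_mul_eval_eq_zero (n := m + 1) E hE_deg hE_even hE0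
  have hinner : ∑ k ∈ Finset.Icc 1 (m + 1), (-1 : ℂ) ^ (m + 1 - k) * ((2 * (m + 1)).choose (m + 1 - k) : ℂ) *
      (4 * (k : ℂ) ^ 2 * ((k : ℂ) ^ 2 - a ^ 2) ^ i * ∑ j ∈ Finset.range (m - i), c i j * (k : ℂ) ^ (2 * j)) = 0 := by
    rw [← key]
    exact Finset.sum_congr rfl fun k _ => by rw [hE_eval]
  rw [hinner, mul_zero]

end RivoalTheorem12

end Literature.NumberTheory.ZetaValues
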